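import Summits.AnomalousDissipation.AnomalousDissipation.Theorems.MomentParityResolvedDissipationTrajectoryUIOfLHEE

/-!
# `GEE ⟹ TUI` and `GEE ⟹ ResolvedDissipation`: the energy equality for GALERKIN LIMITS suffices
# (crux `MomentParity.ResolvedDissipation`, stmt-AnomalousDissipation-14284; line `enstrophy-ui-transfer`, lead c6)

A sharper conjecture-grade leaf. The bracket theorems `LhBracket.resolvedDissipation_of_lerayHopfEnergyEquality` (c3)
and `TrajectoryUIOfLHEE.trajectoryUI_of_lerayHopfEnergyEquality` (c6) assume LHEE — the energy equality between
positive times for EVERY global Leray–Hopf weak solution of NS(ν, f). Both proofs apply it only to Leray–Hopf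
solutions that arise as coefficientwise limits of Hopf–Galerkin FAMILIES of NS(ν, f) (exact steady force `P_N f`)
with strongly `L²`-convergent data. This file records the weaker leaf GEE(ν, f) — the energy equality between
positive times for exactly those GALERKIN LIMITS — and proves GEE ⟹ TUI (same proof) and hence GEE ⟹ U ⟹
`ResolvedDissipation` (landed `TrajectoryUI.resolvedDissipation_of_trajectoryUI`), together with LHEE ⟹ GEE
(`IsHopfGalerkinFamily.isGlobalLerayHopf_limit`). The map of the crux becomes
LHEE ⟹ GEE ⟹ TUI ⟹ U ⟺ RD, all arrows tree theorems; GEE is the natural statement "Fourier–Galerkin limits of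
the forced 3-D Navier–Stokes equations on `T³` conserve energy exactly" (Robinson–Rodrigo–Sadowski 2016 Thm 4.6 gives
only the strong energy INEQUALITY for them), strictly more credible than LHEE in view of possible Leray–Hopf
non-uniqueness, and still conjecture-grade (open for `d = 3`).

* `trajectoryUIAt_of_galerkinLimitEnergyEquality` — GEE(ν, f) ⟹ TUI(f, ν, R).
* `galerkinLimitEnergyEquality_of_lerayHopfEnergyEquality` — LHEE(ν, f) ⟹ GEE(ν, f).
* `trajectoryUI_of_galerkinLimitEnergyEquality`, `resolvedDissipation_of_galerkinLimitEnergyEquality` — global forms.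
* `stub_trajectoryUIOfGalerkinEE` — registered tools stub (the conjunction of the two global forms).
-/

noncomputable section

-- `Summit.<Summit>.<Problem>`: single-conjunct summit, the duplicate namespace segment is mandated.
set_option linter.dupNamespace false

namespace Summit.AnomalousDissipation.AnomalousDissipation.Theorems.MomentParityResolvedDissipation.TrajectoryUIOfGalerkinEE

open MeasureTheory Filter Topology Set
open scoped ENNReal InnerProductSpace RealInnerProductSpace
open Literature.Analysis.FunctionSpaces Literature.Analysis.FluidPDE
open Summit.AnomalousDissipation.AnomalousDissipation.Theses.MomentParity
open Summit.AnomalousDissipation.AnomalousDissipation.Theorems.CubicParityLoud.Negative (T3 R3)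
open Summit.AnomalousDissipation.AnomalousDissipation.Theorems.MomentParityResolvedDissipation
open Literature.Analysis.FunctionSpaces.Torus Literature.Analysis.FluidPDE.Torus UnitAddTorus
open Summit.AnomalousDissipation.AnomalousDissipation.Theorems.MomentParity

/-! ## GEE(ν, f) ⟹ TUI(f, ν, R) -/

/-- **GEE(ν, f) ⟹ TUI(f, ν, R)** — the same assembly under the WEAKER leaf (lead c6): the energy equality between
positive times is assumed only for GALERKIN LIMITS of NS(ν, f), i.e. for coefficientwise limits `u` (measurable lift,
`L²` slices) of Hopf–Galerkin families with the exact steady force whose data converge strongly in `L²` to `u 0`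
(every such `u` is a global Leray–Hopf solution, `IsHopfGalerkinFamily.isGlobalLerayHopf_limit`, so LHEE ⟹ GEE,
`galerkinLimitEnergyEquality_of_lerayHopfEnergyEquality`). The proof of `TrajectoryUIOfLHEE.trajectoryUIAt_of_lerayHopfEnergyEquality`
applies the energy equality only to such a limit, so it goes through verbatim. [folklore argument;
RobinsonRodrigoSadowski2016 Thm 4.6; FMRT2001 Ch. IV (1.31)] -/
theorem trajectoryUIAt_of_galerkinLimitEnergyEquality {ν : ℝ} (hν : 0 < ν) {f : T3 → R3}
    (hf : Torus.IsSmooth f) (hf0 : Torus.HasZeroMean f)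
    (hGEE : ∀ (u₀ : T3 → R3), MemLp u₀ 2 volume → ∀ (N : ℕ → ℕ) (U : ℕ → ℝ → T3 → R3) (u : ℝ → T3 → R3),
      IsHopfGalerkinFamily ν (fun _ => f) u₀ N (fun _ _ => f) U →
      AEStronglyMeasurable (Torus.stLift u) (volume.restrict (Set.Ioi (0 : ℝ) ×ˢ Set.univ)) →
      (∀ t, 0 ≤ t → MemLp (u t) 2 volume) →
      (∀ t, 0 ≤ t → ∀ k, Filter.Tendsto
        (fun n => UnitAddTorus.mFourierCoeff (EuclideanSpace.complexify ∘ U n t) k) Filter.atTop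
        (𝓝 (UnitAddTorus.mFourierCoeff (EuclideanSpace.complexify ∘ u t) k))) →
      Filter.Tendsto (fun n => eLpNorm (U n 0 - u 0) 2 volume) Filter.atTop (𝓝 0) →
      ∀ (t₀ t₁ : ℝ), 0 < t₀ → t₀ ≤ t₁ →
        Torus.kineticEnergy (u t₁) + ν * (∫⁻ τ in Set.Ioo t₀ t₁, Torus.eGradNormSq (u τ)).toReal =
          Torus.kineticEnergy (u t₀) + ∫ τ in t₀..t₁, ∫ x, ⟪f x, u τ x⟫_ℝ)
    (R : ℝ) :
    ∃ T : ℝ, 0 < T ∧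
      ∀ G : ℝ≥0∞, G ≠ ⊤ → ∀ ε : ℝ≥0∞, 0 < ε → ∃ M : ℝ≥0∞, M ≠ ⊤ ∧
        ∀ (N : ℕ) (a : UnitAddTorus (Fin 3) → EuclideanSpace ℝ (Fin 3)),
          IsGalerkinMode N a → Torus.HasZeroMean a → ∫ x, ‖a x‖ ^ 2 ≤ R ^ 2 →
          Torus.eGradNormSq a ≤ G →
          ∫⁻ t in Set.Ioo 0 T, (Set.Ioi M).indicator id
              (Torus.eGradNormSq (Torus.galerkinFlow ν f N t a)) ≤ ε := by
  refine ⟨1, one_pos, fun G hG ε hε => ?_⟩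
  by_contra H
  push Not at H
  -- violators at every natural threshold `m`
  choose Nf af hmode hmean hball hens hviol using fun m : ℕ => H (m : ℝ≥0∞) (ENNReal.natCast_ne_top m)
  -- the `N`-uniform local enstrophy bound (lead c5): `Z ≤ L` on `[0, TG]` along every violator
  obtain ⟨TG, hTG, hloc⟩ :=
    Summit.AnomalousDissipation.AnomalousDissipation.Theorems.MomentParityResolvedDissipation.TrajectoryUILocalWindow.galerkin_enstrophy_local_bound
      hν hf hf0 (G := G.toReal) ENNReal.toReal_nonneg
  have hGof : ENNReal.ofReal G.toReal = G := ENNReal.ofReal_toReal hG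
  set L : ℝ≥0∞ := ENNReal.ofReal (2 * G.toReal + 1)
  have hlocm : ∀ m, ∀ t ∈ Icc (0 : ℝ) TG,
      Torus.eGradNormSq (Torus.galerkinFlow ν f (Nf m) t (af m)) ≤ L := fun m t ht =>
    hloc (Nf m) (af m) (hmode m) (hmean m) (by rw [hGof]; exact hens m) t ht
  by_cases hbdd : ∃ N₀, ∀ m, Nf m ≤ N₀
  · -- bounded orders: S7 makes the integrand vanish at a large threshold
    obtain ⟨N₀, hN₀⟩ := hbdd
    obtain ⟨M₀, hM₀, hbound⟩ := BoundedOrders.stub_boundedOrders ν hν.le f hf R N₀ 1 zero_le_one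
    obtain ⟨m, hm⟩ := ENNReal.exists_nat_gt hM₀
    have hzero : ∫⁻ t in Ioo (0 : ℝ) 1, (Ioi (m : ℝ≥0∞)).indicator id
        (Torus.eGradNormSq (Torus.galerkinFlow ν f (Nf m) t (af m))) = 0 := by
      refine setLIntegral_eq_zero measurableSet_Ioo fun t ht => ?_
      have hle : Torus.eGradNormSq (Torus.galerkinFlow ν f (Nf m) t (af m)) ≤ (m : ℝ≥0∞) :=
        (hbound (Nf m) (hN₀ m) (af m) (hmode m) (hball m) t ⟨ht.1.le, ht.2.le⟩).trans hm.le
      exact indicator_of_notMem (fun hgt : _ < _ => absurd hle (not_le.2 hgt)) id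
    have hv := hviol m
    rw [hzero] at hv
    exact absurd hv (not_lt.2 bot_le)
  · -- unbounded orders: pass to a subsequence with `N → ∞`
    push Not at hbdd
    obtain ⟨ψ, hψ, hNψ⟩ := TrajectoryUIOfLHEE.exists_strictMono_tendsto_of_forall_exists_lt hbdd
    set N : ℕ → ℕ := Nf ∘ ψ
    set a : ℕ → T3 → R3 := af ∘ ψ
    set U : ℕ → ℝ → T3 → R3 := fun j t => Torus.galerkinFlow ν f (N j) t (a j)
    have hF : IsHopfGalerkinFamily ν (fun _ => f) (fun _ => EuclideanSpace.single (0 : Fin 3) R) N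
        (fun _ _ => f) U :=
      TrajectoryUIOfLHEE.isHopfGalerkinFamily_galerkinFlow_of_isGalerkinMode hν.le hf hNψ (fun j => hmode (ψ j))
        fun j => hball (ψ j)
    have hu₀ : MemLp (fun _ : T3 => EuclideanSpace.single (0 : Fin 3) R) 2 volume := memLp_const _
    have hfm := Literature.Analysis.FluidPDE.aestronglyMeasurable_stLift_const hf
      (volume.restrict (Ioi (0 : ℝ) ×ˢ univ))
    have hf₂ : ∀ T : ℝ, 0 < T → ∫⁻ _ in Ioo (0 : ℝ) T, ∫⁻ x, ‖f x‖ₑ ^ 2 < ⊤ := fun T _ =>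
      lintegral_force_lt_top hf T
    -- the limit field along `φ₁`
    obtain ⟨φ₁, hφ₁, u, hum, hu2, hcv⟩ := hF.exists_limitField hν.le hu₀ hfm hf₂
    have hF₁ := hF.comp_strictMono hφ₁
    -- strong `L²` convergence at a.e. time of `(0, 2)` along `φ₂`
    obtain ⟨φ₂, hφ₂, hae⟩ :=
      hF₁.exists_strictMono_ae_tendsto_eLpNorm hν hu₀ hfm hf₂ hum hu2 hcv (T := 2) two_pos
    set Φ : ℕ → ℕ := φ₁ ∘ φ₂
    have hF₂ : IsHopfGalerkinFamily ν (fun _ => f) (fun _ => EuclideanSpace.single (0 : Fin 3) R)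
        (N ∘ Φ) (fun _ _ => f) (U ∘ Φ) := hF₁.comp_strictMono hφ₂
    have hcv₂ : ∀ t, 0 ≤ t → ∀ k, Tendsto
        (fun j => mFourierCoeff (EuclideanSpace.complexify ∘ (U ∘ Φ) j t) k) atTop
        (𝓝 (mFourierCoeff (EuclideanSpace.complexify ∘ u t) k)) :=
      fun t ht k => (hcv t ht k).comp hφ₂.tendsto_atTop
    -- two strong times `s₁ ∈ (0, min TG 1)` and `s₂ ∈ (1, 2)`
    set τ : ℝ := min TG 1
    have hτpos : 0 < τ := lt_min hTG one_pos
    have hτ1 : τ ≤ 1 := min_le_right _ _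
    have hτG : τ ≤ TG := min_le_left _ _
    have hpick : ∀ α β : ℝ, 0 ≤ α → α < β → β ≤ 2 → ∃ s,
        Tendsto (fun j => eLpNorm ((U ∘ φ₁) (φ₂ j) s - u s) 2 volume) atTop (𝓝 0) ∧ s ∈ Ioo α β := by
      intro α β hα hαβ hβ
      have hsub : Ioo α β ⊆ Ioo 0 2 := Ioo_subset_Ioo hα hβ
      have hae' := ae_restrict_of_ae_restrict_of_subset hsub hae
      have hne : NeBot (ae (volume.restrict (Ioo α β))) := by
        rw [ae_neBot, Ne, Measure.restrict_eq_zero, Real.volume_Ioo, ENNReal.ofReal_eq_zero, not_le]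
        linarith
      exact (hae'.and (ae_restrict_mem measurableSet_Ioo)).exists
    obtain ⟨s₁, hs₁conv, hs₁mem⟩ := hpick 0 τ le_rfl hτpos (by linarith)
    obtain ⟨s₂, hs₂conv, hs₂mem⟩ := hpick 1 2 zero_le_one one_lt_two le_rfl
    have hs₁pos : 0 < s₁ := hs₁mem.1
    have hs₁₂ : s₁ < s₂ := by linarith [hs₁mem.2, hs₂mem.1]
    -- strong convergence at time `0` (S8) and the Leray–Hopf limit
    have h0 : Tendsto (fun j => eLpNorm ((U ∘ Φ) j 0 - u 0) 2 volume) atTop (𝓝 0) := by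
      refine InitialStrong.stub_initialStrong G hG (fun j => (U ∘ Φ) j 0) (u 0) (fun j => hF₂.memLp_slice j le_rfl)
        (hu2 0 le_rfl) (fun j => ?_) (hcv₂ 0 le_rfl)
      show Torus.eGradNormSq (Torus.galerkinFlow ν f (N (Φ j)) 0 (a (Φ j))) ≤ G
      rw [Torus.galerkinFlow_zero]
      exact hens (ψ (Φ j))
    -- energy equality of the Galerkin limit on `[s₁, s₂]` (GEE) and the energy passage (S9)
    have hEE := hGEE _ hu₀ (N ∘ Φ) (U ∘ Φ) u hF₂ hum hu2 hcv₂ h0 s₁ s₂ hs₁pos hs₁₂.le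
    have hconvZ := EnergyPassage.stub_energyPassage ν hν f hf _ hu₀ (N ∘ Φ) (U ∘ Φ) u hF₂ hum hu2 hcv₂ s₁ s₂
      hs₁pos.le hs₁₂.le hs₁conv hs₂conv hEE
    -- uniform integrability on `(s₁, s₂)` (S6)
    set μ : Measure ℝ := volume.restrict (Ioo s₁ s₂)
    have hsub2 : Ioo s₁ s₂ ⊆ Ioo 0 2 := Ioo_subset_Ioo hs₁pos.le hs₂mem.2.le
    have hg : ∀ j, AEMeasurable (fun t => Torus.eGradNormSq ((U ∘ Φ) j t)) μ := fun j =>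
      (hF₂.aemeasurable_eGradNormSq j 2).mono_measure (Measure.restrict_mono hsub2 le_rfl)
    have hh : AEMeasurable (fun t => Torus.eGradNormSq (u t)) μ := by
      have hcoef : ∀ k, AEStronglyMeasurable
          (fun t => mFourierCoeff (EuclideanSpace.complexify ∘ u t) k) (volume.restrict (Ioi 0)) := by
        intro k
        refine aestronglyMeasurable_of_tendsto_ae atTop
          (fun j => hF₂.aestronglyMeasurable_mFourierCoeff j k) ?_
        filter_upwards [ae_restrict_mem measurableSet_Ioi] with t ht
        exact hcv₂ t (le_of_lt ht) k
      exact (Torus.aemeasurable_eGradNormSq_of_coeff hcoef).mono_measure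
        (Measure.restrict_mono (Ioo_subset_Ioi_self.trans (Ioi_subset_Ioi hs₁pos.le)) le_rfl)
    have hle : ∀ᵐ t ∂μ, Torus.eGradNormSq (u t) ≤
        liminf (fun j => Torus.eGradNormSq ((U ∘ Φ) j t)) atTop := by
      filter_upwards [ae_restrict_mem measurableSet_Ioo] with t ht
      exact eGradNormSq_le_liminf_of_tendsto_mFourierCoeff hcv₂ (hs₁pos.trans ht.1).le
    have hfin : ∫⁻ t, Torus.eGradNormSq (u t) ∂μ ≠ ⊤ :=
      ((lintegral_mono_set hsub2).trans_lt
        (hF₂.lintegral_eGradNormSq_limit_lt_top hν hu₀ hfm hf₂ hcv₂ two_pos)).ne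
    have hgfin : ∀ j, ∫⁻ t, Torus.eGradNormSq ((U ∘ Φ) j t) ∂μ ≠ ⊤ := fun j =>
      ((lintegral_mono_set hsub2).trans_lt (hF₂.lintegral_eGradNormSq_lt_top j 2)).ne
    obtain ⟨C, hC, hUI⟩ := VitaliUI.stub_vitaliUI μ (fun j t => Torus.eGradNormSq ((U ∘ Φ) j t))
      (fun t => Torus.eGradNormSq (u t)) hg hh hle hfin hgfin hconvZ ε hε
    -- the index: threshold above `max C L`
    have hC'top : max C L ≠ ⊤ := max_ne_top hC ENNReal.ofReal_ne_top
    obtain ⟨j, hj⟩ := ENNReal.exists_nat_gt hC'top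
    have hjm : ((j : ℕ) : ℝ≥0∞) ≤ ((ψ (Φ j) : ℕ) : ℝ≥0∞) := by
      exact_mod_cast (hψ.comp (hφ₁.comp hφ₂)).id_le j
    have hthr : max C L ≤ ((ψ (Φ j) : ℕ) : ℝ≥0∞) := hj.le.trans hjm
    have hCm : C ≤ ((ψ (Φ j) : ℕ) : ℝ≥0∞) := (le_max_left _ _).trans hthr
    have hLm : L ≤ ((ψ (Φ j) : ℕ) : ℝ≥0∞) := (le_max_right _ _).trans hthr
    -- the violation at the original index `m = ψ (Φ j)` is contradicted
    have hv := hviol (ψ (Φ j))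
    have hcover : Ioo (0 : ℝ) 1 ⊆ Ioc 0 s₁ ∪ Ioo s₁ s₂ := fun t ht =>
      (le_or_gt t s₁).elim (fun h => Or.inl ⟨ht.1, h⟩) fun h => Or.inr ⟨h, ht.2.trans hs₂mem.1⟩
    have hpiece₁ : ∫⁻ t in Ioc (0 : ℝ) s₁, (Ioi ((ψ (Φ j) : ℕ) : ℝ≥0∞)).indicator id
        (Torus.eGradNormSq (Torus.galerkinFlow ν f (Nf (ψ (Φ j))) t (af (ψ (Φ j))))) = 0 := by
      refine setLIntegral_eq_zero measurableSet_Ioc fun t ht => ?_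
      have hle' : Torus.eGradNormSq (Torus.galerkinFlow ν f (Nf (ψ (Φ j))) t (af (ψ (Φ j)))) ≤
          ((ψ (Φ j) : ℕ) : ℝ≥0∞) :=
        (hlocm (ψ (Φ j)) t ⟨ht.1.le, ht.2.trans (hs₁mem.2.le.trans hτG)⟩).trans hLm
      exact indicator_of_notMem (fun hgt : _ < _ => absurd hle' (not_le.2 hgt)) id
    have hpiece₂ : ∫⁻ t in Ioo s₁ s₂, (Ioi ((ψ (Φ j) : ℕ) : ℝ≥0∞)).indicator id
        (Torus.eGradNormSq (Torus.galerkinFlow ν f (Nf (ψ (Φ j))) t (af (ψ (Φ j))))) ≤ ε := by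
      refine le_trans (lintegral_mono fun t => ?_) (hUI j)
      exact indicator_le_indicator_of_subset (Ioi_subset_Ioi hCm) (fun _ => zero_le) _
    have hbound : ∫⁻ t in Ioo (0 : ℝ) 1, (Ioi ((ψ (Φ j) : ℕ) : ℝ≥0∞)).indicator id
        (Torus.eGradNormSq (Torus.galerkinFlow ν f (Nf (ψ (Φ j))) t (af (ψ (Φ j))))) ≤ ε :=
      calc ∫⁻ t in Ioo (0 : ℝ) 1, (Ioi ((ψ (Φ j) : ℕ) : ℝ≥0∞)).indicator id
            (Torus.eGradNormSq (Torus.galerkinFlow ν f (Nf (ψ (Φ j))) t (af (ψ (Φ j)))))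
          ≤ ∫⁻ t in Ioc (0 : ℝ) s₁ ∪ Ioo s₁ s₂, (Ioi ((ψ (Φ j) : ℕ) : ℝ≥0∞)).indicator id
              (Torus.eGradNormSq (Torus.galerkinFlow ν f (Nf (ψ (Φ j))) t (af (ψ (Φ j))))) :=
            lintegral_mono_set hcover
        _ ≤ (∫⁻ t in Ioc (0 : ℝ) s₁, (Ioi ((ψ (Φ j) : ℕ) : ℝ≥0∞)).indicator id
              (Torus.eGradNormSq (Torus.galerkinFlow ν f (Nf (ψ (Φ j))) t (af (ψ (Φ j)))))) +
            ∫⁻ t in Ioo s₁ s₂, (Ioi ((ψ (Φ j) : ℕ) : ℝ≥0∞)).indicator id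
              (Torus.eGradNormSq (Torus.galerkinFlow ν f (Nf (ψ (Φ j))) t (af (ψ (Φ j))))) :=
            lintegral_union_le _ _ _
        _ ≤ 0 + ε := add_le_add hpiece₁.le hpiece₂
        _ = ε := zero_add ε
    exact absurd hv (not_lt.2 hbound)



/-! ## LHEE ⟹ GEE and the global forms -/

/-- **LHEE(ν, f) ⟹ GEE(ν, f)**: a coefficientwise limit of a Hopf–Galerkin family with strongly convergent data is a
global Leray–Hopf solution from `u 0` (`IsHopfGalerkinFamily.isGlobalLerayHopf_limit`, Robinson–Rodrigo–Sadowski 2016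
Thm 4.4/4.6), so the Leray–Hopf energy equality specialises to Galerkin limits. [folklore] -/
theorem galerkinLimitEnergyEquality_of_lerayHopfEnergyEquality {ν : ℝ} (hν : 0 < ν)
    {f : UnitAddTorus (Fin 3) → EuclideanSpace ℝ (Fin 3)} (hf : Torus.IsSmooth f)
    (hLHEE : ∀ (u₀ : UnitAddTorus (Fin 3) → EuclideanSpace ℝ (Fin 3))
      (u : ℝ → UnitAddTorus (Fin 3) → EuclideanSpace ℝ (Fin 3)),
      Torus.IsGlobalLerayHopf ν (fun _ => f) u₀ u →
    ∀ (t₀ t₁ : ℝ), 0 < t₀ → t₀ ≤ t₁ →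
      Torus.kineticEnergy (u t₁) + ν * (∫⁻ τ in Set.Ioo t₀ t₁, Torus.eGradNormSq (u τ)).toReal =
        Torus.kineticEnergy (u t₀) + ∫ τ in t₀..t₁, ∫ x, ⟪f x, u τ x⟫_ℝ) :
    ∀ (u₀ : UnitAddTorus (Fin 3) → EuclideanSpace ℝ (Fin 3)), MemLp u₀ 2 volume →
      ∀ (N : ℕ → ℕ) (U : ℕ → ℝ → UnitAddTorus (Fin 3) → EuclideanSpace ℝ (Fin 3))
        (u : ℝ → UnitAddTorus (Fin 3) → EuclideanSpace ℝ (Fin 3)),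
      IsHopfGalerkinFamily ν (fun _ => f) u₀ N (fun _ _ => f) U →
      AEStronglyMeasurable (Torus.stLift u) (volume.restrict (Set.Ioi (0 : ℝ) ×ˢ Set.univ)) →
      (∀ t, 0 ≤ t → MemLp (u t) 2 volume) →
      (∀ t, 0 ≤ t → ∀ k, Filter.Tendsto
        (fun n => UnitAddTorus.mFourierCoeff (EuclideanSpace.complexify ∘ U n t) k) Filter.atTop
        (𝓝 (UnitAddTorus.mFourierCoeff (EuclideanSpace.complexify ∘ u t) k))) →
      Filter.Tendsto (fun n => eLpNorm (U n 0 - u 0) 2 volume) Filter.atTop (𝓝 0) →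
      ∀ (t₀ t₁ : ℝ), 0 < t₀ → t₀ ≤ t₁ →
        Torus.kineticEnergy (u t₁) + ν * (∫⁻ τ in Set.Ioo t₀ t₁, Torus.eGradNormSq (u τ)).toReal =
          Torus.kineticEnergy (u t₀) + ∫ τ in t₀..t₁, ∫ x, ⟪f x, u τ x⟫_ℝ := by
  intro u₀ hu₀ N U u hF hum hu hc h0 t₀ t₁ ht₀ ht₀₁
  have hfm := Literature.Analysis.FluidPDE.aestronglyMeasurable_stLift_const hf
    (volume.restrict (Ioi (0 : ℝ) ×ˢ univ))
  have hf₂ : ∀ T : ℝ, 0 < T → ∫⁻ _ in Ioo (0 : ℝ) T, ∫⁻ x, ‖f x‖ₑ ^ 2 < ⊤ := fun T _ =>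
    lintegral_force_lt_top hf T
  exact hLHEE (u 0) u (hF.isGlobalLerayHopf_limit hν hu₀ hfm hf₂ hum hu hc h0) t₀ t₁ ht₀ ht₀₁

/-- **GEE ⟹ TUI (global form)**: the energy equality for Galerkin limits of NS with smooth divergence-free mean-zero
steady forces implies S1 `stub_trajectoryUI` of line `enstrophy-ui-transfer` (verbatim). -/
theorem trajectoryUI_of_galerkinLimitEnergyEquality
    (hGEE : ∀ (ν : ℝ), 0 < ν → ∀ (f : UnitAddTorus (Fin 3) → EuclideanSpace ℝ (Fin 3)),
      Torus.IsSmooth f → Torus.IsDivFree f → Torus.HasZeroMean f →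
      ∀ (u₀ : UnitAddTorus (Fin 3) → EuclideanSpace ℝ (Fin 3)), MemLp u₀ 2 volume →
      ∀ (N : ℕ → ℕ) (U : ℕ → ℝ → UnitAddTorus (Fin 3) → EuclideanSpace ℝ (Fin 3))
        (u : ℝ → UnitAddTorus (Fin 3) → EuclideanSpace ℝ (Fin 3)),
      IsHopfGalerkinFamily ν (fun _ => f) u₀ N (fun _ _ => f) U →
      AEStronglyMeasurable (Torus.stLift u) (volume.restrict (Set.Ioi (0 : ℝ) ×ˢ Set.univ)) →
      (∀ t, 0 ≤ t → MemLp (u t) 2 volume) →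
      (∀ t, 0 ≤ t → ∀ k, Filter.Tendsto
        (fun n => UnitAddTorus.mFourierCoeff (EuclideanSpace.complexify ∘ U n t) k) Filter.atTop
        (𝓝 (UnitAddTorus.mFourierCoeff (EuclideanSpace.complexify ∘ u t) k))) →
      Filter.Tendsto (fun n => eLpNorm (U n 0 - u 0) 2 volume) Filter.atTop (𝓝 0) →
      ∀ (t₀ t₁ : ℝ), 0 < t₀ → t₀ ≤ t₁ →
        Torus.kineticEnergy (u t₁) + ν * (∫⁻ τ in Set.Ioo t₀ t₁, Torus.eGradNormSq (u τ)).toReal =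
          Torus.kineticEnergy (u t₀) + ∫ τ in t₀..t₁, ∫ x, ⟪f x, u τ x⟫_ℝ) :
    ∀ f : UnitAddTorus (Fin 3) → EuclideanSpace ℝ (Fin 3),
      Torus.IsSmooth f → Torus.IsDivFree f → Torus.HasZeroMean f →
      ∀ ν : ℝ, 0 < ν → ∀ R : ℝ, ∃ T : ℝ, 0 < T ∧
        ∀ G : ℝ≥0∞, G ≠ ⊤ → ∀ ε : ℝ≥0∞, 0 < ε → ∃ M : ℝ≥0∞, M ≠ ⊤ ∧
          ∀ (N : ℕ) (a : UnitAddTorus (Fin 3) → EuclideanSpace ℝ (Fin 3)),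
            IsGalerkinMode N a → Torus.HasZeroMean a → ∫ x, ‖a x‖ ^ 2 ≤ R ^ 2 →
            Torus.eGradNormSq a ≤ G →
            ∫⁻ t in Set.Ioo 0 T, (Set.Ioi M).indicator id
                (Torus.eGradNormSq (Torus.galerkinFlow ν f N t a)) ≤ ε :=
  fun f hf hdiv hf0 ν hν R =>
    trajectoryUIAt_of_galerkinLimitEnergyEquality hν hf hf0 (hGEE ν hν f hf hdiv hf0) R

/-- **GEE ⟹ `ResolvedDissipation`**: the crux BY NAME from the energy equality for GALERKIN LIMITS (the weaker leaf),
through the Galerkin-intrinsic chain GEE ⟹ TUI ⟹ U ⟹ RD (`TrajectoryUI.resolvedDissipation_of_trajectoryUI`).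
CONDITIONAL on the conjecture-grade GEE (open for `d = 3`), credits nothing. -/
theorem resolvedDissipation_of_galerkinLimitEnergyEquality
    (hGEE : ∀ (ν : ℝ), 0 < ν → ∀ (f : UnitAddTorus (Fin 3) → EuclideanSpace ℝ (Fin 3)),
      Torus.IsSmooth f → Torus.IsDivFree f → Torus.HasZeroMean f →
      ∀ (u₀ : UnitAddTorus (Fin 3) → EuclideanSpace ℝ (Fin 3)), MemLp u₀ 2 volume →
      ∀ (N : ℕ → ℕ) (U : ℕ → ℝ → UnitAddTorus (Fin 3) → EuclideanSpace ℝ (Fin 3))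
        (u : ℝ → UnitAddTorus (Fin 3) → EuclideanSpace ℝ (Fin 3)),
      IsHopfGalerkinFamily ν (fun _ => f) u₀ N (fun _ _ => f) U →
      AEStronglyMeasurable (Torus.stLift u) (volume.restrict (Set.Ioi (0 : ℝ) ×ˢ Set.univ)) →
      (∀ t, 0 ≤ t → MemLp (u t) 2 volume) →
      (∀ t, 0 ≤ t → ∀ k, Filter.Tendsto
        (fun n => UnitAddTorus.mFourierCoeff (EuclideanSpace.complexify ∘ U n t) k) Filter.atTop
        (𝓝 (UnitAddTorus.mFourierCoeff (EuclideanSpace.complexify ∘ u t) k))) →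
      Filter.Tendsto (fun n => eLpNorm (U n 0 - u 0) 2 volume) Filter.atTop (𝓝 0) →
      ∀ (t₀ t₁ : ℝ), 0 < t₀ → t₀ ≤ t₁ →
        Torus.kineticEnergy (u t₁) + ν * (∫⁻ τ in Set.Ioo t₀ t₁, Torus.eGradNormSq (u τ)).toReal =
          Torus.kineticEnergy (u t₀) + ∫ τ in t₀..t₁, ∫ x, ⟪f x, u τ x⟫_ℝ) :
    ResolvedDissipation :=
  TrajectoryUI.resolvedDissipation_of_trajectoryUI (trajectoryUI_of_galerkinLimitEnergyEquality hGEE)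

/-- **LHEE ⟹ GEE (global form).** -/
theorem galerkinLimitEnergyEquality_of_lerayHopfEnergyEquality_all
    (hLHEE : ∀ (ν : ℝ), 0 < ν → ∀ (f : UnitAddTorus (Fin 3) → EuclideanSpace ℝ (Fin 3)),
      Torus.IsSmooth f → Torus.IsDivFree f → Torus.HasZeroMean f →
    ∀ (u₀ : UnitAddTorus (Fin 3) → EuclideanSpace ℝ (Fin 3))
      (u : ℝ → UnitAddTorus (Fin 3) → EuclideanSpace ℝ (Fin 3)),
      Torus.IsGlobalLerayHopf ν (fun _ => f) u₀ u →
    ∀ (t₀ t₁ : ℝ), 0 < t₀ → t₀ ≤ t₁ →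
      Torus.kineticEnergy (u t₁) + ν * (∫⁻ τ in Set.Ioo t₀ t₁, Torus.eGradNormSq (u τ)).toReal =
        Torus.kineticEnergy (u t₀) + ∫ τ in t₀..t₁, ∫ x, ⟪f x, u τ x⟫_ℝ) :
    ∀ (ν : ℝ), 0 < ν → ∀ (f : UnitAddTorus (Fin 3) → EuclideanSpace ℝ (Fin 3)),
      Torus.IsSmooth f → Torus.IsDivFree f → Torus.HasZeroMean f →
      ∀ (u₀ : UnitAddTorus (Fin 3) → EuclideanSpace ℝ (Fin 3)), MemLp u₀ 2 volume →
      ∀ (N : ℕ → ℕ) (U : ℕ → ℝ → UnitAddTorus (Fin 3) → EuclideanSpace ℝ (Fin 3))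
        (u : ℝ → UnitAddTorus (Fin 3) → EuclideanSpace ℝ (Fin 3)),
      IsHopfGalerkinFamily ν (fun _ => f) u₀ N (fun _ _ => f) U →
      AEStronglyMeasurable (Torus.stLift u) (volume.restrict (Set.Ioi (0 : ℝ) ×ˢ Set.univ)) →
      (∀ t, 0 ≤ t → MemLp (u t) 2 volume) →
      (∀ t, 0 ≤ t → ∀ k, Filter.Tendsto
        (fun n => UnitAddTorus.mFourierCoeff (EuclideanSpace.complexify ∘ U n t) k) Filter.atTop
        (𝓝 (UnitAddTorus.mFourierCoeff (EuclideanSpace.complexify ∘ u t) k))) →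
      Filter.Tendsto (fun n => eLpNorm (U n 0 - u 0) 2 volume) Filter.atTop (𝓝 0) →
      ∀ (t₀ t₁ : ℝ), 0 < t₀ → t₀ ≤ t₁ →
        Torus.kineticEnergy (u t₁) + ν * (∫⁻ τ in Set.Ioo t₀ t₁, Torus.eGradNormSq (u τ)).toReal =
          Torus.kineticEnergy (u t₀) + ∫ τ in t₀..t₁, ∫ x, ⟪f x, u τ x⟫_ℝ :=
  fun ν hν f hf hdiv hf0 => galerkinLimitEnergyEquality_of_lerayHopfEnergyEquality hν hf (hLHEE ν hν f hf hdiv hf0)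

/-! ## Registered tools stub -/

/-- **Registered tools stub `stub_trajectoryUIOfGalerkinEE` of stmt-AnomalousDissipation-14284** (line
`enstrophy-ui-transfer`, lead c6): (i) GEE ⟹ TUI and (ii) GEE ⟹ `ResolvedDissipation`. [folklore] -/
theorem stub_trajectoryUIOfGalerkinEE :
    ((∀ (ν : ℝ), 0 < ν → ∀ (f : UnitAddTorus (Fin 3) → EuclideanSpace ℝ (Fin 3)),
    Literature.Analysis.FunctionSpaces.Torus.IsSmooth f → Literature.Analysis.FunctionSpaces.Torus.IsDivFree f →
    Literature.Analysis.FunctionSpaces.Torus.HasZeroMean f →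
    ∀ (u₀ : UnitAddTorus (Fin 3) → EuclideanSpace ℝ (Fin 3)), MeasureTheory.MemLp u₀ 2 MeasureTheory.volume →
    ∀ (N : ℕ → ℕ) (U : ℕ → ℝ → UnitAddTorus (Fin 3) → EuclideanSpace ℝ (Fin 3))
    (u : ℝ → UnitAddTorus (Fin 3) → EuclideanSpace ℝ (Fin 3)),
    Literature.Analysis.FluidPDE.IsHopfGalerkinFamily ν (fun _ => f) u₀ N (fun _ _ => f) U →
    MeasureTheory.AEStronglyMeasurable (Literature.Analysis.FunctionSpaces.Torus.stLift u)
    (MeasureTheory.volume.restrict (Set.Ioi (0 : ℝ) ×ˢ Set.univ)) →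
    (∀ t : ℝ, 0 ≤ t → MeasureTheory.MemLp (u t) 2 MeasureTheory.volume) →
    (∀ t : ℝ, 0 ≤ t → ∀ k : Fin 3 → ℤ, Filter.Tendsto
    (fun n => UnitAddTorus.mFourierCoeff (Literature.Analysis.FunctionSpaces.EuclideanSpace.complexify ∘ U n t) k)
    Filter.atTop (nhds (UnitAddTorus.mFourierCoeff (Literature.Analysis.FunctionSpaces.EuclideanSpace.complexify ∘ u t) k))) →
    Filter.Tendsto (fun n => MeasureTheory.eLpNorm (U n 0 - u 0) 2 MeasureTheory.volume) Filter.atTop (nhds 0) →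
    ∀ (t₀ t₁ : ℝ), 0 < t₀ → t₀ ≤ t₁ →
    Literature.Analysis.FunctionSpaces.Torus.kineticEnergy (u t₁) +
    ν * (∫⁻ τ in Set.Ioo t₀ t₁, Literature.Analysis.FunctionSpaces.Torus.eGradNormSq (u τ)).toReal =
    Literature.Analysis.FunctionSpaces.Torus.kineticEnergy (u t₀) + ∫ τ in t₀..t₁, ∫ x, inner ℝ (f x) (u τ x)) →
    ∀ f : UnitAddTorus (Fin 3) → EuclideanSpace ℝ (Fin 3),
    Literature.Analysis.FunctionSpaces.Torus.IsSmooth f → Literature.Analysis.FunctionSpaces.Torus.IsDivFree f →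
    Literature.Analysis.FunctionSpaces.Torus.HasZeroMean f →
    ∀ ν : ℝ, 0 < ν → ∀ R : ℝ, ∃ T : ℝ, 0 < T ∧
    ∀ G : ENNReal, G ≠ ⊤ → ∀ ε : ENNReal, 0 < ε → ∃ M : ENNReal, M ≠ ⊤ ∧
    ∀ (N : ℕ) (a : UnitAddTorus (Fin 3) → EuclideanSpace ℝ (Fin 3)),
    Literature.Analysis.FluidPDE.IsGalerkinMode N a → Literature.Analysis.FunctionSpaces.Torus.HasZeroMean a →
    ∫ x, ‖a x‖ ^ 2 ≤ R ^ 2 → Literature.Analysis.FunctionSpaces.Torus.eGradNormSq a ≤ G →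
    ∫⁻ t in Set.Ioo 0 T, (Set.Ioi M).indicator id
    (Literature.Analysis.FunctionSpaces.Torus.eGradNormSq (Literature.Analysis.FluidPDE.Torus.galerkinFlow ν f N t a)) ≤ ε) ∧
    ((∀ (ν : ℝ), 0 < ν → ∀ (f : UnitAddTorus (Fin 3) → EuclideanSpace ℝ (Fin 3)),
    Literature.Analysis.FunctionSpaces.Torus.IsSmooth f → Literature.Analysis.FunctionSpaces.Torus.IsDivFree f →
    Literature.Analysis.FunctionSpaces.Torus.HasZeroMean f →
    ∀ (u₀ : UnitAddTorus (Fin 3) → EuclideanSpace ℝ (Fin 3)), MeasureTheory.MemLp u₀ 2 MeasureTheory.volume →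
    ∀ (N : ℕ → ℕ) (U : ℕ → ℝ → UnitAddTorus (Fin 3) → EuclideanSpace ℝ (Fin 3))
    (u : ℝ → UnitAddTorus (Fin 3) → EuclideanSpace ℝ (Fin 3)),
    Literature.Analysis.FluidPDE.IsHopfGalerkinFamily ν (fun _ => f) u₀ N (fun _ _ => f) U →
    MeasureTheory.AEStronglyMeasurable (Literature.Analysis.FunctionSpaces.Torus.stLift u)
    (MeasureTheory.volume.restrict (Set.Ioi (0 : ℝ) ×ˢ Set.univ)) →
    (∀ t : ℝ, 0 ≤ t → MeasureTheory.MemLp (u t) 2 MeasureTheory.volume) →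
    (∀ t : ℝ, 0 ≤ t → ∀ k : Fin 3 → ℤ, Filter.Tendsto
    (fun n => UnitAddTorus.mFourierCoeff (Literature.Analysis.FunctionSpaces.EuclideanSpace.complexify ∘ U n t) k)
    Filter.atTop (nhds (UnitAddTorus.mFourierCoeff (Literature.Analysis.FunctionSpaces.EuclideanSpace.complexify ∘ u t) k))) →
    Filter.Tendsto (fun n => MeasureTheory.eLpNorm (U n 0 - u 0) 2 MeasureTheory.volume) Filter.atTop (nhds 0) →
    ∀ (t₀ t₁ : ℝ), 0 < t₀ → t₀ ≤ t₁ →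
    Literature.Analysis.FunctionSpaces.Torus.kineticEnergy (u t₁) +
    ν * (∫⁻ τ in Set.Ioo t₀ t₁, Literature.Analysis.FunctionSpaces.Torus.eGradNormSq (u τ)).toReal =
    Literature.Analysis.FunctionSpaces.Torus.kineticEnergy (u t₀) + ∫ τ in t₀..t₁, ∫ x, inner ℝ (f x) (u τ x)) →
    Summit.AnomalousDissipation.AnomalousDissipation.Theses.MomentParity.ResolvedDissipation) :=
  ⟨trajectoryUI_of_galerkinLimitEnergyEquality, resolvedDissipation_of_galerkinLimitEnergyEquality⟩

end Summit.AnomalousDissipation.AnomalousDissipation.Theorems.MomentParityResolvedDissipation.TrajectoryUIOfGalerkinEE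

end
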